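import Mathlib
import Summits.NavierStokesRegularity.NavierStokesRegularity.Theorems.PlaneEnergyCeilingSlabEnergyIdentitySlab

/-!
# Route PlaneEnergyCeiling · crux `BoundedPlanarEnergyRegularity` — stub `stub_rieszCeiling`

Helper file for the crux item stmt-NavierStokesRegularity-16921 (`BoundedPlanarEnergyRegularity`,
route `PlaneEnergyCeiling`); it proves, with EXACTLY the registered signature, the stub
`stub_rieszCeiling` of the line `Cruxes/BoundedPlanarEnergyRegularity/Lines/radon_topside.lean` (the
"Radon back-projection tooth"), and lands `--supports` that item. Mathlib plus the slab chart of
`Theorems/PlaneEnergyCeilingSlabEnergyIdentitySlab.lean` only.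

**Statement.** If an a.e.-strongly measurable field `w` on `ℝ³` has slab energies
`∫_{c−δ<⟪y,e⟫<c+δ} |w|² ≤ 2δM` for every unit `e`, every offset `c` and every `δ > 0`, then the
Newtonian potential of `|w|²` is at most `2M` at every point: `∫ |w(y)|²/|y − x| dy ≤ 2M`.

**Proof (averaging over directions in the unit ball).** For `δ > 0` put
`Φ_δ(z) = vol (B ∩ {e : |⟪z,e⟫| < δ})`, `B` the unit ball of `ℝ³`. By Tonelli,
`∫ |w(y)|² Φ_δ(y − x) dy = ∫_{e∈B} ∫_{|⟪y−x,e⟫|<δ} |w(y)|² dy de`, and the inner integral is a slab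
integral of half-width `δ/|e|` for the unit normal `e/|e|`, hence `≤ 2δM/|e|`; with
`∫_B |e|⁻¹ de = 2π` (polar coordinates, `integral_fun_norm_addHaar`) the left side is `≤ 4πδM`.
On the other hand, for `|z| ≥ δ` the set `B ∩ {|⟪z,e⟫| < δ}` contains (after the reflection taking
`z/|z|` to the coordinate axis `e₂`, which preserves `B` and Lebesgue measure) the cylinder
`{|e₂| < ε} × {disc of radius 1 − ε}`, `ε = δ/|z|`, of volume `2ε · π(1 − ε)²`; so
`∫_{|y−x|≥δ} |w(y)|² |y−x|⁻¹ (1 − δ/|y−x|)² dy ≤ 2M` for every `δ > 0`, and Fatou along `δ = 1/(n+1)`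
gives the claim (the point `y = x` is a null set). This is the `n = 3` back-projection inequality
behind Helgason, *Geometric Analysis on Symmetric Spaces*, Ch. I, Thm. 2.1.
-/

noncomputable section

-- single-conjunct summit: `Summit.<Summit>.<Problem>` repeats the name by the D-0017 layout
set_option linter.dupNamespace false

namespace Summit.NavierStokesRegularity.NavierStokesRegularity.Theorems.BoundedPlanarEnergyRegularity

open MeasureTheory Set Filter Topology Metric Real WithLp
open scoped ENNReal RealInnerProductSpace
open Summit.NavierStokesRegularity.NavierStokesRegularity.Theorems.PlaneEnergyCeilingSlabEnergyIdentity

/-- `∫_{B} |e|⁻¹ de = 2π` over the unit ball `B` of `ℝ³` (polar coordinates: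
`3 · (4π/3) · ∫₀¹ r² · r⁻¹ dr`). -/
theorem lintegral_ball_inv_norm :
    ∫⁻ e in ball (0 : EuclideanSpace ℝ (Fin 3)) 1, ENNReal.ofReal (‖e‖⁻¹) = ENNReal.ofReal (2 * π) := by
  set g : ℝ → ℝ := (Iio (1 : ℝ)).indicator fun r => r⁻¹ with hg
  have hgnn : ∀ e : EuclideanSpace ℝ (Fin 3), 0 ≤ g ‖e‖ := fun e => by
    simp only [hg, Set.indicator_apply, mem_Iio]
    split_ifs
    · exact inv_nonneg.2 (norm_nonneg _)
    · exact le_rfl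
  have h1 : ∀ e : EuclideanSpace ℝ (Fin 3),
      (ball (0 : EuclideanSpace ℝ (Fin 3)) 1).indicator (fun e => ENNReal.ofReal (‖e‖⁻¹)) e =
        ENNReal.ofReal (g ‖e‖) := by
    intro e
    by_cases he : ‖e‖ < 1
    · rw [indicator_of_mem (mem_ball_zero_iff.2 he), hg, indicator_of_mem (mem_Iio.2 he)]
    · rw [indicator_of_notMem (fun h' => he (mem_ball_zero_iff.1 h')), hg,
        indicator_of_notMem (fun h' => he (mem_Iio.1 h')), ENNReal.ofReal_zero]
  have hrad : ∀ y ∈ Ioi (0 : ℝ),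
      y ^ (Module.finrank ℝ (EuclideanSpace ℝ (Fin 3)) - 1) • g y =
        (Ioo (0 : ℝ) 1).indicator (fun y => y) y := by
    intro y hy
    have hy0 : (0 : ℝ) < y := hy
    rw [finrank_euclideanSpace_fin]
    simp only [hg, Set.indicator_apply, mem_Iio, mem_Ioo, hy0, true_and, smul_eq_mul]
    split_ifs with h
    · show y ^ 2 * y⁻¹ = y
      rw [pow_two, mul_assoc, mul_inv_cancel₀ hy0.ne', mul_one]
    · simp
  have hint1 : IntegrableOn (fun y : ℝ => (Ioo (0 : ℝ) 1).indicator (fun y => y) y) (Ioi 0) := by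
    have : IntegrableOn (fun y : ℝ => y) (Ioo (0 : ℝ) 1) :=
      (continuous_id.integrableOn_Icc (a := 0) (b := 1)).mono_set Ioo_subset_Icc_self
    exact (this.integrable_indicator measurableSet_Ioo).integrableOn
  have hint : Integrable (fun e : EuclideanSpace ℝ (Fin 3) => g ‖e‖) volume := by
    rw [integrable_fun_norm_addHaar volume]
    exact hint1.congr_fun (fun y hy => (hrad y hy).symm) measurableSet_Ioi
  have hreal : (volume : Measure (EuclideanSpace ℝ (Fin 3))).real (ball 0 1) = π * 4 / 3 := by
    rw [measureReal_def, EuclideanSpace.volume_ball_fin_three]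
    simp [ENNReal.toReal_ofReal (by positivity : (0 : ℝ) ≤ π * 4 / 3)]
  calc ∫⁻ e in ball (0 : EuclideanSpace ℝ (Fin 3)) 1, ENNReal.ofReal (‖e‖⁻¹)
      = ∫⁻ e, (ball (0 : EuclideanSpace ℝ (Fin 3)) 1).indicator
          (fun e => ENNReal.ofReal (‖e‖⁻¹)) e := (lintegral_indicator measurableSet_ball _).symm
    _ = ∫⁻ e, ENNReal.ofReal (g ‖e‖) := by simp_rw [h1]
    _ = ENNReal.ofReal (∫ e, g ‖e‖) :=
        (ofReal_integral_eq_lintegral_ofReal hint (Eventually.of_forall hgnn)).symm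
    _ = ENNReal.ofReal (2 * π) := by
        congr 1
        rw [integral_fun_norm_addHaar volume g, setIntegral_congr_fun measurableSet_Ioi hrad,
          setIntegral_indicator measurableSet_Ioo,
          (inter_eq_right.2 Ioo_subset_Ioi_self : Ioi (0 : ℝ) ∩ Ioo 0 1 = Ioo 0 1),
          ← integral_Ioc_eq_integral_Ioo, ← intervalIntegral.integral_of_le zero_le_one, integral_id,
          hreal, finrank_euclideanSpace_fin]
        simp only [nsmul_eq_mul, smul_eq_mul]
        ring

/-- The volume of `B ∩ {e : |⟪u,e⟫| < ε}`, `B` the unit ball of `ℝ³`, does not depend on the unit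
vector `u`: the reflection exchanging `u` and the axis vector `e₂` preserves `B` and Lebesgue
measure. -/
theorem volume_ball_inter_slab_eq (u : EuclideanSpace ℝ (Fin 3)) (hu : ‖u‖ = 1) (ε : ℝ) :
    volume (ball (0 : EuclideanSpace ℝ (Fin 3)) 1 ∩ {e : EuclideanSpace ℝ (Fin 3) | |⟪u, e⟫| < ε}) =
      volume (ball (0 : EuclideanSpace ℝ (Fin 3)) 1 ∩ {e : EuclideanSpace ℝ (Fin 3) | |e 2| < ε}) := by
  set e₂ : EuclideanSpace ℝ (Fin 3) := EuclideanSpace.single 2 1 with he₂_def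
  have he₂ : ‖e₂‖ = 1 := by simp [he₂_def]
  set R : EuclideanSpace ℝ (Fin 3) ≃ₗᵢ[ℝ] EuclideanSpace ℝ (Fin 3) := (ℝ ∙ (u - e₂))ᗮ.reflection
    with hR
  have hRu : R u = e₂ := Submodule.reflection_sub (by rw [hu, he₂])
  have hcoord : ∀ e : EuclideanSpace ℝ (Fin 3), (R e) 2 = ⟪u, e⟫ := by
    intro e
    have h1 : (R e) 2 = ⟪e₂, R e⟫ := by simp [he₂_def, EuclideanSpace.inner_single_left]
    rw [h1, ← hRu, LinearIsometryEquiv.inner_map_map]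
  have hmeas : MeasurableSet (ball (0 : EuclideanSpace ℝ (Fin 3)) 1 ∩
      {e : EuclideanSpace ℝ (Fin 3) | |e 2| < ε}) :=
    measurableSet_ball.inter
      (measurableSet_lt ((EuclideanSpace.proj (2 : Fin 3)).continuous.measurable.abs)
        measurable_const)
  have hpre : R ⁻¹' (ball (0 : EuclideanSpace ℝ (Fin 3)) 1 ∩ {e : EuclideanSpace ℝ (Fin 3) | |e 2| < ε}) =
      ball (0 : EuclideanSpace ℝ (Fin 3)) 1 ∩ {e : EuclideanSpace ℝ (Fin 3) | |⟪u, e⟫| < ε} := by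
    ext e
    simp only [mem_preimage, mem_inter_iff, mem_ball_zero_iff, mem_setOf_eq, LinearIsometryEquiv.norm_map,
      hcoord]
  rw [← hpre]
  exact R.measurePreserving.measure_preimage hmeas.nullMeasurableSet

/-- The cylinder `{|e₂| < ε} × {disc of radius 1 − ε}` lies in `B ∩ {e : |e₂| < ε}`, so the latter
has volume at least `2ε · π(1 − ε)²` (`0 < ε ≤ 1`). -/
theorem volume_cylinder_le {ε : ℝ} (hε : 0 < ε) (hε1 : ε ≤ 1) :
    ENNReal.ofReal (2 * ε) * (ENNReal.ofReal (1 - ε) ^ 2 * ENNReal.ofReal π) ≤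
      volume (ball (0 : EuclideanSpace ℝ (Fin 3)) 1 ∩ {e : EuclideanSpace ℝ (Fin 3) | |e 2| < ε}) := by
  obtain ⟨Ψ, hΨ, hΨapply⟩ := exists_slabChart
  have hsub : Ψ.symm ⁻¹' (Ioo (-ε) ε ×ˢ ball (0 : EuclideanSpace ℝ (Fin 2)) (1 - ε)) ⊆
      ball (0 : EuclideanSpace ℝ (Fin 3)) 1 ∩ {e : EuclideanSpace ℝ (Fin 3) | |e 2| < ε} := by
    intro e he
    rw [mem_preimage] at he
    generalize hp : Ψ.symm e = p at he
    obtain ⟨c, y⟩ := p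
    have heq : e = toLp 2 ![y 0, y 1, c] := by
      rw [← hΨapply, ← hp, MeasurableEquiv.apply_symm_apply]
    subst heq
    simp only [mem_prod, mem_Ioo, mem_ball_zero_iff] at he
    obtain ⟨⟨hc1, hc2⟩, hy⟩ := he
    refine ⟨?_, ?_⟩
    · rw [mem_ball_zero_iff]
      have hn : ‖(toLp 2 ![y 0, y 1, c] : EuclideanSpace ℝ (Fin 3))‖ ^ 2 = ‖y‖ ^ 2 + c ^ 2 := by
        rw [EuclideanSpace.norm_sq_eq, EuclideanSpace.norm_sq_eq y, Fin.sum_univ_three,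
          Fin.sum_univ_two]
        simp [sq_abs]
      have hy2 : ‖y‖ ^ 2 < (1 - ε) ^ 2 := by nlinarith [norm_nonneg y]
      have hc2' : c ^ 2 < ε ^ 2 := sq_lt_sq' hc1 hc2
      have hlt : ‖(toLp 2 ![y 0, y 1, c] : EuclideanSpace ℝ (Fin 3))‖ ^ 2 < 1 := by
        nlinarith [hε.le, hε1]
      by_contra hge
      push Not at hge
      nlinarith [norm_nonneg (toLp 2 ![y 0, y 1, c] : EuclideanSpace ℝ (Fin 3))]
    · show |(toLp 2 ![y 0, y 1, c] : EuclideanSpace ℝ (Fin 3)) 2| < ε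
      rw [toLp_vec3_apply_two]
      exact abs_lt.2 ⟨hc1, hc2⟩
  calc ENNReal.ofReal (2 * ε) * (ENNReal.ofReal (1 - ε) ^ 2 * ENNReal.ofReal π)
      = volume (Ioo (-ε) ε ×ˢ ball (0 : EuclideanSpace ℝ (Fin 2)) (1 - ε)) := by
        rw [Measure.volume_eq_prod, Measure.prod_prod, Real.volume_Ioo,
          EuclideanSpace.volume_ball_fin_two]
        congr 1
        ring_nf
    _ = volume (Ψ.symm ⁻¹' (Ioo (-ε) ε ×ˢ ball (0 : EuclideanSpace ℝ (Fin 2)) (1 - ε))) :=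
        ((hΨ.symm Ψ).measure_preimage_equiv _).symm
    _ ≤ volume (ball (0 : EuclideanSpace ℝ (Fin 3)) 1 ∩ {e : EuclideanSpace ℝ (Fin 3) | |e 2| < ε}) :=
        measure_mono hsub

/-- **Stub `stub_rieszCeiling` of the line `radon_topside` (the Radon back-projection tooth).** If an
a.e.-strongly measurable field `w` on `ℝ³` has slab energies `∫_{c−δ<⟪y,e⟫<c+δ} |w|² ≤ 2δM` for every
unit normal `e`, every offset `c` and every half-width `δ > 0`, then the Newtonian potential of
`|w|²` is bounded by `2M` at every point: `∫ |w(y)|² / |y − x| dy ≤ 2M` (average the slab bound over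
directions `e` in the unit ball, compare with the cylinder inside `B ∩ {|⟪y−x,e⟫| < δ}`, and let
`δ ↓ 0` by Fatou; the `n = 3` back-projection inequality, Helgason, Geometric Analysis on Symmetric
Spaces, Ch. I, Thm. 2.1). -/
theorem stub_rieszCeiling :
    ∀ (w : EuclideanSpace ℝ (Fin 3) → EuclideanSpace ℝ (Fin 3)),
      MeasureTheory.AEStronglyMeasurable w MeasureTheory.volume →
      ∀ (M : ℝ), 0 ≤ M →
      (∀ (e : EuclideanSpace ℝ (Fin 3)), ‖e‖ = 1 → ∀ (c δ : ℝ), 0 < δ →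
        ∫⁻ y in {y : EuclideanSpace ℝ (Fin 3) | c - δ < inner ℝ y e ∧ inner ℝ y e < c + δ},
            ‖w y‖ₑ ^ 2 ≤ ENNReal.ofReal (2 * δ * M)) →
      ∀ (x : EuclideanSpace ℝ (Fin 3)),
        ∫⁻ y, ‖w y‖ₑ ^ 2 / ENNReal.ofReal ‖y - x‖ ≤ ENNReal.ofReal (2 * M) := by
  intro w hw M hM hslab x
  set f : EuclideanSpace ℝ (Fin 3) → ℝ≥0∞ := fun y => ‖w y‖ₑ ^ 2 with hf_def
  have hf : AEMeasurable f volume := hw.enorm.pow_const 2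
  have hf_top : ∀ y, f y ≠ ⊤ := fun y => ENNReal.pow_ne_top enorm_ne_top
  -- ### Step 1: the direction-averaged slab bound
  have hkey : ∀ δ : ℝ, 0 < δ →
      ∫⁻ y, f y * volume (ball (0 : EuclideanSpace ℝ (Fin 3)) 1 ∩
          {e : EuclideanSpace ℝ (Fin 3) | |⟪y - x, e⟫| < δ}) ≤
        ENNReal.ofReal (2 * δ * M) * ENNReal.ofReal (2 * π) := by
    intro δ hδ
    have hT : MeasurableSet {p : EuclideanSpace ℝ (Fin 3) × EuclideanSpace ℝ (Fin 3) | |⟪p.1 - x, p.2⟫| < δ} :=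
      measurableSet_lt ((continuous_fst.sub continuous_const).inner continuous_snd).abs.measurable
        measurable_const
    set F : EuclideanSpace ℝ (Fin 3) → EuclideanSpace ℝ (Fin 3) → ℝ≥0∞ := fun y e =>
      {p : EuclideanSpace ℝ (Fin 3) × EuclideanSpace ℝ (Fin 3) | |⟪p.1 - x, p.2⟫| < δ}.indicator
        (fun p => f p.1) (y, e) with hF
    have hFmeas : AEMeasurable (Function.uncurry F)
        ((volume : Measure (EuclideanSpace ℝ (Fin 3))).prod
          (volume.restrict (ball (0 : EuclideanSpace ℝ (Fin 3)) 1))) := by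
      have : Function.uncurry F =
          {p : EuclideanSpace ℝ (Fin 3) × EuclideanSpace ℝ (Fin 3) | |⟪p.1 - x, p.2⟫| < δ}.indicator
            (fun p => f p.1) := by
        funext p
        rfl
      rw [this]
      exact hf.comp_fst.indicator hT
    have hinner_y : ∀ y, ∫⁻ e in ball (0 : EuclideanSpace ℝ (Fin 3)) 1, F y e =
        f y * volume (ball (0 : EuclideanSpace ℝ (Fin 3)) 1 ∩
          {e : EuclideanSpace ℝ (Fin 3) | |⟪y - x, e⟫| < δ}) := by
      intro y
      have hSy : MeasurableSet {e : EuclideanSpace ℝ (Fin 3) | |⟪y - x, e⟫| < δ} :=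
        measurableSet_lt (continuous_const.inner continuous_id).abs.measurable measurable_const
      have h1 : (fun e => F y e) = {e : EuclideanSpace ℝ (Fin 3) | |⟪y - x, e⟫| < δ}.indicator
          (fun _ => f y) := by
        funext e
        simp only [hF, Set.indicator_apply, mem_setOf_eq]
      rw [h1, lintegral_indicator_const hSy, Measure.restrict_apply hSy, inter_comm]
    have hinner_e : ∀ e : EuclideanSpace ℝ (Fin 3), e ≠ 0 →
        ∫⁻ y, F y e ≤ ENNReal.ofReal (2 * δ * M) * ENNReal.ofReal (‖e‖⁻¹) := by
      intro e he
      have hne : 0 < ‖e‖ := norm_pos_iff.2 he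
      have hSe : MeasurableSet {y : EuclideanSpace ℝ (Fin 3) | |⟪y - x, e⟫| < δ} :=
        measurableSet_lt ((continuous_id.sub continuous_const).inner continuous_const).abs.measurable
          measurable_const
      have h1 : (fun y => F y e) = {y : EuclideanSpace ℝ (Fin 3) | |⟪y - x, e⟫| < δ}.indicator f := by
        funext y
        simp only [hF, Set.indicator_apply, mem_setOf_eq]
      rw [h1, lintegral_indicator hSe]
      set u : EuclideanSpace ℝ (Fin 3) := ‖e‖⁻¹ • e with hu
      have hu1 : ‖u‖ = 1 := by
        rw [hu, norm_smul, norm_inv, norm_norm, inv_mul_cancel₀ hne.ne']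
      have hyu : ∀ y : EuclideanSpace ℝ (Fin 3), ⟪y, u⟫ = ⟪y, e⟫ / ‖e‖ := fun y => by
        rw [hu, real_inner_smul_right, inv_mul_eq_div]
      have hset : {y : EuclideanSpace ℝ (Fin 3) | |⟪y - x, e⟫| < δ} =
          {y : EuclideanSpace ℝ (Fin 3) | ⟪x, e⟫ / ‖e‖ - δ / ‖e‖ < ⟪y, u⟫ ∧ ⟪y, u⟫ < ⟪x, e⟫ / ‖e‖ + δ / ‖e‖} := by
        ext y
        simp only [mem_setOf_eq]
        rw [hyu y, ← sub_div, ← add_div, div_lt_div_iff_of_pos_right hne,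
          div_lt_div_iff_of_pos_right hne, inner_sub_left, abs_sub_lt_iff]
        constructor <;> rintro ⟨h₁, h₂⟩ <;> exact ⟨by linarith, by linarith⟩
      rw [hset]
      calc ∫⁻ y in {y : EuclideanSpace ℝ (Fin 3) | ⟪x, e⟫ / ‖e‖ - δ / ‖e‖ < ⟪y, u⟫ ∧
              ⟪y, u⟫ < ⟪x, e⟫ / ‖e‖ + δ / ‖e‖}, f y
          ≤ ENNReal.ofReal (2 * (δ / ‖e‖) * M) := hslab u hu1 _ _ (div_pos hδ hne)
        _ = ENNReal.ofReal (2 * δ * M) * ENNReal.ofReal (‖e‖⁻¹) := by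
          rw [← ENNReal.ofReal_mul (by positivity)]
          congr 1
          rw [div_eq_mul_inv]
          ring
    have hae : ∀ᵐ e ∂(volume.restrict (ball (0 : EuclideanSpace ℝ (Fin 3)) 1)),
        ∫⁻ y, F y e ≤ ENNReal.ofReal (2 * δ * M) * ENNReal.ofReal (‖e‖⁻¹) := by
      have h0 : ∀ᵐ e ∂(volume : Measure (EuclideanSpace ℝ (Fin 3))), e ≠ (0 : EuclideanSpace ℝ (Fin 3)) := by
        rw [ae_iff]
        simp [measure_singleton]
      exact (ae_restrict_of_ae h0).mono fun e he => hinner_e e he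
    have hm : Measurable fun e : EuclideanSpace ℝ (Fin 3) => ENNReal.ofReal (‖e‖⁻¹) :=
      measurable_norm.inv.ennreal_ofReal
    calc ∫⁻ y, f y * volume (ball (0 : EuclideanSpace ℝ (Fin 3)) 1 ∩
            {e : EuclideanSpace ℝ (Fin 3) | |⟪y - x, e⟫| < δ})
        = ∫⁻ y, ∫⁻ e in ball (0 : EuclideanSpace ℝ (Fin 3)) 1, F y e := by
          refine lintegral_congr fun y => ?_
          rw [hinner_y]
      _ = ∫⁻ e in ball (0 : EuclideanSpace ℝ (Fin 3)) 1, ∫⁻ y, F y e := lintegral_lintegral_swap hFmeas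
      _ ≤ ∫⁻ e in ball (0 : EuclideanSpace ℝ (Fin 3)) 1,
            ENNReal.ofReal (2 * δ * M) * ENNReal.ofReal (‖e‖⁻¹) := lintegral_mono_ae hae
      _ = ENNReal.ofReal (2 * δ * M) *
            ∫⁻ e in ball (0 : EuclideanSpace ℝ (Fin 3)) 1, ENNReal.ofReal (‖e‖⁻¹) :=
          lintegral_const_mul _ hm
      _ = ENNReal.ofReal (2 * δ * M) * ENNReal.ofReal (2 * π) := by rw [lintegral_ball_inv_norm]
  -- ### Step 2: the cylinder lower bound for the averaging weight
  have hlow : ∀ δ : ℝ, 0 < δ → ∀ z : EuclideanSpace ℝ (Fin 3), δ ≤ ‖z‖ →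
      ENNReal.ofReal (2 * π * δ * (‖z‖⁻¹ * (1 - δ / ‖z‖) ^ 2)) ≤
        volume (ball (0 : EuclideanSpace ℝ (Fin 3)) 1 ∩ {e : EuclideanSpace ℝ (Fin 3) | |⟪z, e⟫| < δ}) := by
    intro δ hδ z hz
    have hzpos : 0 < ‖z‖ := hδ.trans_le hz
    have hz0 : z ≠ 0 := norm_pos_iff.1 hzpos
    have hε0 : 0 < δ / ‖z‖ := div_pos hδ hzpos
    have hε1 : δ / ‖z‖ ≤ 1 := (div_le_one hzpos).2 hz
    set u : EuclideanSpace ℝ (Fin 3) := ‖z‖⁻¹ • z with hu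
    have hu1 : ‖u‖ = 1 := by
      rw [hu, norm_smul, norm_inv, norm_norm, inv_mul_cancel₀ hzpos.ne']
    have hset : {e : EuclideanSpace ℝ (Fin 3) | |⟪z, e⟫| < δ} =
        {e : EuclideanSpace ℝ (Fin 3) | |⟪u, e⟫| < δ / ‖z‖} := by
      ext e
      simp only [mem_setOf_eq]
      rw [hu, real_inner_smul_left, abs_mul, abs_inv, abs_norm, inv_mul_eq_div,
        div_lt_div_iff_of_pos_right hzpos]
    rw [hset, volume_ball_inter_slab_eq u hu1 (δ / ‖z‖)]
    calc ENNReal.ofReal (2 * π * δ * (‖z‖⁻¹ * (1 - δ / ‖z‖) ^ 2))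
        = ENNReal.ofReal (2 * (δ / ‖z‖)) *
            (ENNReal.ofReal (1 - δ / ‖z‖) ^ 2 * ENNReal.ofReal π) := by
          rw [← ENNReal.ofReal_pow (by linarith), ← ENNReal.ofReal_mul (by positivity),
            ← ENNReal.ofReal_mul (by positivity)]
          congr 1
          rw [div_eq_mul_inv]
          ring
      _ ≤ volume (ball (0 : EuclideanSpace ℝ (Fin 3)) 1 ∩
            {e : EuclideanSpace ℝ (Fin 3) | |e 2| < δ / ‖z‖}) := volume_cylinder_le hε0 hε1
  -- ### Step 3: the truncated bound for every `δ > 0`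
  have hstep : ∀ δ : ℝ, 0 < δ →
      ∫⁻ y, {y : EuclideanSpace ℝ (Fin 3) | δ ≤ ‖y - x‖}.indicator
          (fun y => f y * ENNReal.ofReal (‖y - x‖⁻¹ * (1 - δ / ‖y - x‖) ^ 2)) y ≤
        ENNReal.ofReal (2 * M) := by
    intro δ hδ
    have hc : ENNReal.ofReal (2 * π * δ) ≠ 0 := (ENNReal.ofReal_pos.2 (by positivity)).ne'
    have hc' : ENNReal.ofReal (2 * π * δ) ≠ ⊤ := ENNReal.ofReal_ne_top
    rw [← ENNReal.mul_le_mul_iff_right hc hc', ← lintegral_const_mul' _ _ hc']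
    calc ∫⁻ y, ENNReal.ofReal (2 * π * δ) * {y : EuclideanSpace ℝ (Fin 3) | δ ≤ ‖y - x‖}.indicator
            (fun y => f y * ENNReal.ofReal (‖y - x‖⁻¹ * (1 - δ / ‖y - x‖) ^ 2)) y
        ≤ ∫⁻ y, f y * volume (ball (0 : EuclideanSpace ℝ (Fin 3)) 1 ∩
            {e : EuclideanSpace ℝ (Fin 3) | |⟪y - x, e⟫| < δ}) := by
          refine lintegral_mono fun y => ?_
          by_cases hy : δ ≤ ‖y - x‖
          · rw [indicator_of_mem (show y ∈ {y : EuclideanSpace ℝ (Fin 3) | δ ≤ ‖y - x‖} from hy),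
              mul_left_comm]
            refine mul_le_mul_right ?_ _
            rw [← ENNReal.ofReal_mul (by positivity)]
            exact hlow δ hδ (y - x) hy
          · simp only [Set.indicator_apply, mem_setOf_eq, hy, if_false, mul_zero, zero_le]
      _ ≤ ENNReal.ofReal (2 * δ * M) * ENNReal.ofReal (2 * π) := hkey δ hδ
      _ = ENNReal.ofReal (2 * π * δ) * ENNReal.ofReal (2 * M) := by
          rw [← ENNReal.ofReal_mul (by positivity), ← ENNReal.ofReal_mul (by positivity)]
          congr 1
          ring
  -- ### Step 4: Fatou along `δ = 1/(n+1)`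
  set h : ℕ → EuclideanSpace ℝ (Fin 3) → ℝ≥0∞ := fun n y =>
    {y : EuclideanSpace ℝ (Fin 3) | 1 / ((n : ℝ) + 1) ≤ ‖y - x‖}.indicator
      (fun y => f y * ENNReal.ofReal (‖y - x‖⁻¹ * (1 - (1 / ((n : ℝ) + 1)) / ‖y - x‖) ^ 2)) y with hh
  have hhmeas : ∀ n, AEMeasurable (h n) volume := by
    intro n
    refine AEMeasurable.indicator ?_ (measurableSet_le measurable_const (measurable_id.sub_const x).norm)
    exact hf.mul (Measurable.aemeasurable (by fun_prop))
  have hlim : ∀ y : EuclideanSpace ℝ (Fin 3), y ≠ x →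
      Tendsto (fun n => h n y) atTop (𝓝 (f y * ENNReal.ofReal (‖y - x‖⁻¹))) := by
    intro y hy
    have hr : 0 < ‖y - x‖ := norm_pos_iff.2 (sub_ne_zero.2 hy)
    have hδ : Tendsto (fun n : ℕ => 1 / ((n : ℝ) + 1)) atTop (𝓝 0) := tendsto_one_div_add_atTop_nhds_zero_nat
    have hev : ∀ᶠ n : ℕ in atTop, 1 / ((n : ℝ) + 1) ≤ ‖y - x‖ :=
      (hδ.eventually (Iio_mem_nhds hr)).mono fun n hn => le_of_lt hn
    have h1 : Tendsto (fun n : ℕ => f y *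
        ENNReal.ofReal (‖y - x‖⁻¹ * (1 - (1 / ((n : ℝ) + 1)) / ‖y - x‖) ^ 2)) atTop
        (𝓝 (f y * ENNReal.ofReal (‖y - x‖⁻¹))) := by
      refine ENNReal.Tendsto.const_mul ?_ (Or.inr (hf_top y))
      refine ENNReal.tendsto_ofReal ?_
      have : Tendsto (fun n : ℕ => ‖y - x‖⁻¹ * (1 - (1 / ((n : ℝ) + 1)) / ‖y - x‖) ^ 2) atTop
          (𝓝 (‖y - x‖⁻¹ * (1 - 0 / ‖y - x‖) ^ 2)) :=
        tendsto_const_nhds.mul ((tendsto_const_nhds.sub (hδ.div_const _)).pow 2)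
      simpa using this
    refine h1.congr' ?_
    filter_upwards [hev] with n hn
    simp only [hh]
    rw [indicator_of_mem (show y ∈ {y : EuclideanSpace ℝ (Fin 3) | 1 / ((n : ℝ) + 1) ≤ ‖y - x‖} from hn)]
  have hF_ae : (fun y => f y / ENNReal.ofReal ‖y - x‖) =ᵐ[volume]
      fun y => liminf (fun n => h n y) atTop := by
    have h0 : ∀ᵐ y ∂(volume : Measure (EuclideanSpace ℝ (Fin 3))), y ≠ x := by
      rw [ae_iff]
      simp [measure_singleton]
    filter_upwards [h0] with y hy
    have hr : 0 < ‖y - x‖ := norm_pos_iff.2 (sub_ne_zero.2 hy)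
    rw [(hlim y hy).liminf_eq, div_eq_mul_inv, ENNReal.ofReal_inv_of_pos hr]
  calc ∫⁻ y, f y / ENNReal.ofReal ‖y - x‖
      = ∫⁻ y, liminf (fun n => h n y) atTop := lintegral_congr_ae hF_ae
    _ ≤ liminf (fun n => ∫⁻ y, h n y) atTop := lintegral_liminf_le' hhmeas
    _ ≤ ENNReal.ofReal (2 * M) :=
        liminf_le_of_frequently_le'
          (Frequently.of_forall fun n => hstep (1 / ((n : ℝ) + 1)) Nat.one_div_pos_of_nat)

end Summit.NavierStokesRegularity.NavierStokesRegularity.Theorems.BoundedPlanarEnergyRegularity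

end
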